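import Literature.Geometry.Riemannian.ConjugatePointsExp
import Literature.Geometry.Riemannian.SimpleManifoldBallRadialDiffeo
import HarnessLib

/-!
# The exit time of geodesics from an interior point of a strictly convex non-trapping domain
(PSU §3.2 / the domain `D_x` of Prop. 3.7.10, sublevel rendering)

Setting of the discharge of `PaternainSaloUhlmann2023_simple_sublevel_ball`
(`SimpleManifoldBall.lean`): a compact manifold `M` modelled on a finite-dimensional real inner
product space `E` (model `𝓘(ℝ, E)`), a `C^∞` Riemannian metric `g`, its (complete) Levi-Civita
connection, a `C^∞` function `ρ` with sublevel domain `D = {ρ ≤ 0}` which is strictly convex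
(`IsStrictlyConvexSublevel g ρ`) and non-trapping (`IsNonTrappingSublevel g ρ`), and an interior
point `x₀` (`ρ x₀ < 0`). For `u ∈ T_{x₀}M = E` let `γ_u = maximalGeodesic g.leviCivita x₀ u` and

* `exitSet u = {c ≥ 0 | γ_u([0, c]) ⊆ D}`, an initial segment of `[0, ∞)`, bounded for `u ≠ 0`
  (non-trapping) with maximum `R u = sSup (exitSet u) > 0` — the exit parameter, PSU's
  `τ(x₀, u/|u|)/|u|` (Def. 3.1.1: "`τ(x,v)` … the exit time of the maximal geodesic");
* `R (a • u) = R u / a` (`a > 0`, rescaling lemma), `ρ(γ_u(R u)) = 0`, and `ρ(γ_u t) < 0` for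
  `0 ≤ t < R u` (strict convexity: a geodesic segment in `D` meets `∂D` only at its endpoints,
  `IsStrictlyConvexSublevel.neg_of_mem_Ioo_of_isGeodesic`; PSU's uses of Lemma 3.1.12);
* `R` is continuous on `E ∖ {0}` (the exit is transversal/clean: upper semicontinuity from the
  definition, lower semicontinuity from the interior property and compactness) — PSU Lemma 3.2.3
  ("`τ` is continuous on `SM`") in the present rendering;
* the radial function `u ↦ R u * ‖u‖` is positively `0`-homogeneous, continuous off `0` and
  pinched between positive constants; it cuts out the domain of the exponential map
  `D_{x₀} = {u | γ_u([0,1]) ⊆ D} = {u | u = 0 ∨ ‖u‖ ≤ R u ‖u‖}` (compact) and its interior part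
  `U_{x₀} = {u | γ_u([0,1]) ⊆ {ρ < 0}} = {u | u = 0 ∨ ‖u‖ < R u ‖u‖}` (open), the sets to which
  `exists_homeomorph_radial_closedBall` and `exists_contDiff_radialEquiv` apply.

All statements are theorems about the explicit `sSup`; no definitions, no named facts.

## References

* G. P. Paternain, M. Salo, G. Uhlmann, *Geometric Inverse Problems* (2023): Def. 3.1.1,
  Lemma 3.1.12, Lemma 3.2.3, (3.22) and Prop. 3.7.10, proof of Prop. 3.8.5.
-/

noncomputable section

open Bundle Set Filter Function Metric
open scoped Manifold ContDiff Topology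

namespace Literature.Geometry.Riemannian

open Literature.Geometry.Lorentzian

variable {E : Type*} [NormedAddCommGroup E] [InnerProductSpace ℝ E] [FiniteDimensional ℝ E]
  [CompleteSpace E] {M : Type*} [TopologicalSpace M] [ChartedSpace E M]
  [IsManifold 𝓘(ℝ, E) ∞ M] [T2Space M] [CompactSpace M]
  (g : PseudoRiemannianMetric 𝓘(ℝ, E) ∞ E (TangentSpace 𝓘(ℝ, E) : M → Type _))
  [g.HasLeviCivita]

/-! ### Standing consequences of the hypotheses -/

/-- On a compact manifold a `C^∞` Riemannian metric is geodesically complete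
(`isGeodesicallyComplete_of_compactSpace`). [cite: LeeRiemannianManifolds2018, Cor. 6.22] -/
theorem isGeodesicallyComplete_of_smooth (hg : g.IsRiemannian) :
    IsGeodesicallyComplete g.leviCivita :=
  isGeodesicallyComplete_of_compactSpace g (WithTop.coe_le_coe.2 le_top) hg

omit [T2Space M] [CompactSpace M] in
/-- The Levi-Civita connection of a `C^∞` metric is `C¹` in Mathlib's global sense. [folklore] -/
theorem contMDiffCovariantDerivative_leviCivita_smooth :
    CovariantDerivative.ContMDiffCovariantDerivative g.leviCivita 1 :=
  contMDiffCovariantDerivative_leviCivita_of_two_le g (WithTop.coe_le_coe.2 le_top)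

omit [T2Space M] [CompactSpace M] in
/-- The Levi-Civita connection of a `C^∞` metric is `C^∞` in Mathlib's global sense. [folklore] -/
theorem contMDiffCovariantDerivative_leviCivita_smooth_infty :
    CovariantDerivative.ContMDiffCovariantDerivative g.leviCivita ∞ :=
  ⟨g.isLocallyContMDiff_leviCivita_holds ⊤ (le_refl _) univ isOpen_univ⟩

/-- **Joint continuity of the geodesics from `x₀`**: `(t, u) ↦ γ_u(t)` is continuous (indeed
`C^∞`, `contMDiff_maximalGeodesic_family`). [cite: LeeRiemannianManifolds2018, Prop. 5.19] -/
theorem continuous_maximalGeodesic_family (hg : g.IsRiemannian) (x₀ : M) :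
    Continuous fun q : ℝ × E ↦
      maximalGeodesic g.leviCivita x₀ q.2 q.1 := by
  haveI := contMDiffCovariantDerivative_leviCivita_smooth g
  haveI := contMDiffCovariantDerivative_leviCivita_smooth_infty g
  exact (contMDiff_maximalGeodesic_family (isGeodesicallyComplete_of_smooth g hg) x₀).continuous

/-- Continuity of `u ↦ γ_u(t)` for fixed `t`. [cite: LeeRiemannianManifolds2018, Prop. 5.19] -/
theorem continuous_maximalGeodesic_apply (hg : g.IsRiemannian) (x₀ : M) (t : ℝ) :
    Continuous fun u : E ↦ maximalGeodesic g.leviCivita x₀ u t :=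
  (continuous_maximalGeodesic_family g hg x₀).comp (continuous_const.prodMk continuous_id)

/-- Continuity of the geodesic `t ↦ γ_u(t)`. [folklore] -/
theorem continuous_maximalGeodesic (hg : g.IsRiemannian) (x₀ : M) (u : E) :
    Continuous fun t : ℝ ↦ maximalGeodesic g.leviCivita x₀ u t :=
  (continuous_maximalGeodesic_family g hg x₀).comp (continuous_id.prodMk continuous_const)

/-! ### The exit set and the exit parameter `R u = sSup (exitSet u)` -/

section ExitSet

variable {g} {ρ : M → ℝ} {x₀ : M}

/-- `0` lies in the exit set of every `u` when `x₀ ∈ D`. [folklore] -/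
theorem zero_mem_exitSet (hg : g.IsRiemannian) (hx₀ : ρ x₀ ≤ 0) (u : E) :
    (0 : ℝ) ∈ {c : ℝ | 0 ≤ c ∧ ∀ t ∈ Icc (0 : ℝ) c,
      ρ (maximalGeodesic g.leviCivita x₀ u t) ≤ 0} := by
  haveI := contMDiffCovariantDerivative_leviCivita_smooth g
  refine ⟨le_rfl, fun t ht ↦ ?_⟩
  have ht0 : t = 0 := le_antisymm ht.2 ht.1
  rw [ht0]
  exact (congrArg ρ
    (isGeodesic_maximalGeodesic (isGeodesicallyComplete_of_smooth g hg) x₀ u).2.1).trans_le hx₀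

omit [CompleteSpace E] [T2Space M] [CompactSpace M] in
/-- The exit set is an initial segment: down-closed in `[0, ∞)`. [folklore] -/
theorem mem_exitSet_of_le {u : E} {c c' : ℝ} (hc : 0 ≤ c) (hcc' : c ≤ c')
    (h : c' ∈ {c : ℝ | 0 ≤ c ∧ ∀ t ∈ Icc (0 : ℝ) c,
      ρ (maximalGeodesic g.leviCivita x₀ u t) ≤ 0}) :
    c ∈ {c : ℝ | 0 ≤ c ∧ ∀ t ∈ Icc (0 : ℝ) c,
      ρ (maximalGeodesic g.leviCivita x₀ u t) ≤ 0} :=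
  ⟨hc, fun t ht ↦ h.2 t ⟨ht.1, ht.2.trans hcc'⟩⟩

/-- **The exit set of a non-zero vector is bounded** (non-trapping: the geodesic `γ_u` reaches
`{ρ > 0}` at some `T > 0`, and no `c ≥ T` is in the exit set). [cite: PaternainSaloUhlmann2023, Def. 3.1.3] -/
theorem bddAbove_exitSet (hg : g.IsRiemannian) (hnt : IsNonTrappingSublevel g ρ) (hx₀ : ρ x₀ ≤ 0)
    {u : E} (hu : u ≠ 0) :
    BddAbove {c : ℝ | 0 ≤ c ∧ ∀ t ∈ Icc (0 : ℝ) c,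
      ρ (maximalGeodesic g.leviCivita x₀ u t) ≤ 0} := by
  haveI := contMDiffCovariantDerivative_leviCivita_smooth g
  obtain ⟨hγ, h0, hv⟩ := isGeodesic_maximalGeodesic (isGeodesicallyComplete_of_smooth g hg) x₀
    u
  obtain ⟨T, hT, hρT⟩ := hnt _ hγ ((congrArg ρ h0).trans_le hx₀) (hv.trans_ne hu)
  refine ⟨T, fun c hc ↦ ?_⟩
  by_contra hlt
  push Not at hlt
  exact absurd (hc.2 T ⟨hT.le, hlt.le⟩) (not_le.2 hρT)

/-- **The exit parameter lies in the exit set**: `γ_u([0, R u]) ⊆ D` for `R u = sSup (exitSet u)`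
(`u ≠ 0`): below `R u` by the supremum property, at `R u` by continuity. [cite: PaternainSaloUhlmann2023, Def. 3.1.1] -/
theorem sSup_mem_exitSet (hg : g.IsRiemannian) (hρc : Continuous ρ)
    (hnt : IsNonTrappingSublevel g ρ) (hx₀ : ρ x₀ ≤ 0) {u : E} (hu : u ≠ 0) :
    sSup {c : ℝ | 0 ≤ c ∧ ∀ t ∈ Icc (0 : ℝ) c,
        ρ (maximalGeodesic g.leviCivita x₀ u t) ≤ 0} ∈
      {c : ℝ | 0 ≤ c ∧ ∀ t ∈ Icc (0 : ℝ) c,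
        ρ (maximalGeodesic g.leviCivita x₀ u t) ≤ 0} := by
  set C := {c : ℝ | 0 ≤ c ∧ ∀ t ∈ Icc (0 : ℝ) c,
    ρ (maximalGeodesic g.leviCivita x₀ u t) ≤ 0} with hC
  have hne : C.Nonempty := ⟨0, zero_mem_exitSet hg hx₀ u⟩
  have hbdd : BddAbove C := bddAbove_exitSet hg hnt hx₀ hu
  have h0 : 0 ≤ sSup C := le_csSup hbdd (zero_mem_exitSet hg hx₀ u)
  -- below the supremum
  have hlt : ∀ t, 0 ≤ t → t < sSup C →
      ρ (maximalGeodesic g.leviCivita x₀ u t) ≤ 0 := by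
    intro t ht0 ht
    obtain ⟨c, hcC, htc⟩ := exists_lt_of_lt_csSup hne ht
    exact hcC.2 t ⟨ht0, htc.le⟩
  refine ⟨h0, fun t ht ↦ ?_⟩
  rcases ht.2.lt_or_eq with h | h
  · exact hlt t ht.1 h
  · -- at the supremum, by continuity from the left (or `t = 0`)
    rcases h0.lt_or_eq with hpos | hzero
    · have hcont : ContinuousAt (fun t : ℝ ↦
          ρ (maximalGeodesic g.leviCivita x₀ u t)) t :=
        (hρc.comp (continuous_maximalGeodesic g hg x₀ u)).continuousAt
      have hmem : ∀ᶠ t' in 𝓝[<] t,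
          ρ (maximalGeodesic g.leviCivita x₀ u t') ≤ 0 := by
        have h1 : ∀ᶠ t' in 𝓝[<] t, (0 : ℝ) < t' := by
          refine mem_nhdsWithin_of_mem_nhds (lt_mem_nhds ?_)
          rw [h]; exact hpos
        filter_upwards [h1, self_mem_nhdsWithin] with t' ht'0 ht't
        exact hlt t' ht'0.le (by rw [← h]; exact ht't)
      exact le_of_tendsto (hcont.tendsto.mono_left nhdsWithin_le_nhds) hmem
    · have ht0 : t = 0 := by rw [h, ← hzero]
      rw [ht0]
      exact (zero_mem_exitSet hg hx₀ u).2 0 ⟨le_rfl, le_rfl⟩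

/-- **Membership in the exit set = being below the exit parameter** (for `c ≥ 0`, `u ≠ 0`).
[cite: PaternainSaloUhlmann2023, Def. 3.1.1] -/
theorem mem_exitSet_iff_le_sSup (hg : g.IsRiemannian) (hρc : Continuous ρ)
    (hnt : IsNonTrappingSublevel g ρ) (hx₀ : ρ x₀ ≤ 0) {u : E} (hu : u ≠ 0) {c : ℝ} (hc : 0 ≤ c) :
    c ∈ {c : ℝ | 0 ≤ c ∧ ∀ t ∈ Icc (0 : ℝ) c,
        ρ (maximalGeodesic g.leviCivita x₀ u t) ≤ 0} ↔
      c ≤ sSup {c : ℝ | 0 ≤ c ∧ ∀ t ∈ Icc (0 : ℝ) c,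
        ρ (maximalGeodesic g.leviCivita x₀ u t) ≤ 0} := by
  refine ⟨fun h ↦ le_csSup (bddAbove_exitSet hg hnt hx₀ hu) h, fun h ↦ ?_⟩
  exact mem_exitSet_of_le hc h (sSup_mem_exitSet hg hρc hnt hx₀ hu)

/-- **The exit parameter is positive** when `x₀` is an interior point (`ρ x₀ < 0`): `ρ ∘ γ_u < 0`
near `t = 0`. [folklore] -/
theorem sSup_exitSet_pos (hg : g.IsRiemannian) (hρc : Continuous ρ)
    (hnt : IsNonTrappingSublevel g ρ) (hx₀ : ρ x₀ < 0) {u : E} (hu : u ≠ 0) :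
    0 < sSup {c : ℝ | 0 ≤ c ∧ ∀ t ∈ Icc (0 : ℝ) c,
        ρ (maximalGeodesic g.leviCivita x₀ u t) ≤ 0} := by
  haveI := contMDiffCovariantDerivative_leviCivita_smooth g
  have h0 : maximalGeodesic g.leviCivita x₀ u 0 = x₀ :=
    (isGeodesic_maximalGeodesic (isGeodesicallyComplete_of_smooth g hg) x₀ _).2.1
  have hcont : Continuous fun t : ℝ ↦
      ρ (maximalGeodesic g.leviCivita x₀ u t) :=
    hρc.comp (continuous_maximalGeodesic g hg x₀ u)
  have hev : ∀ᶠ t : ℝ in 𝓝 0,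
      ρ (maximalGeodesic g.leviCivita x₀ u t) < 0 :=
    hcont.continuousAt.eventually (gt_mem_nhds ((congrArg ρ h0).trans_lt hx₀))
  obtain ⟨δ, hδ, hδρ⟩ := Metric.eventually_nhds_iff.1 hev
  have hmem : δ / 2 ∈ {c : ℝ | 0 ≤ c ∧ ∀ t ∈ Icc (0 : ℝ) c,
      ρ (maximalGeodesic g.leviCivita x₀ u t) ≤ 0} := by
    refine ⟨by positivity, fun t ht ↦ (hδρ ?_).le⟩
    rw [dist_zero_right, Real.norm_eq_abs, abs_of_nonneg ht.1]
    linarith [ht.2]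
  exact lt_of_lt_of_le (by positivity) (le_csSup (bddAbove_exitSet hg hnt hx₀.le hu) hmem)

/-- **`ρ` vanishes at the exit point**: `ρ(γ_u(R u)) = 0` (if it were `< 0`, compactness of
`[0, R u]` and continuity would put a larger parameter in the exit set). [cite: PaternainSaloUhlmann2023, Def. 3.1.1] -/
theorem apply_sSup_exitSet_eq_zero (hg : g.IsRiemannian) (hρc : Continuous ρ)
    (hnt : IsNonTrappingSublevel g ρ) (hx₀ : ρ x₀ ≤ 0) {u : E} (hu : u ≠ 0) :
    ρ (maximalGeodesic g.leviCivita x₀ u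
      (sSup {c : ℝ | 0 ≤ c ∧ ∀ t ∈ Icc (0 : ℝ) c,
        ρ (maximalGeodesic g.leviCivita x₀ u t) ≤ 0})) = 0 := by
  set C := {c : ℝ | 0 ≤ c ∧ ∀ t ∈ Icc (0 : ℝ) c,
    ρ (maximalGeodesic g.leviCivita x₀ u t) ≤ 0} with hC
  have hmem := sSup_mem_exitSet hg hρc hnt hx₀ hu
  rw [← hC] at hmem
  have hbdd : BddAbove C := bddAbove_exitSet hg hnt hx₀ hu
  refine le_antisymm (hmem.2 _ ⟨hmem.1, le_rfl⟩) ?_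
  by_contra hneg
  push Not at hneg
  -- `ρ ∘ γ_u < 0` near `R u`, so a slightly larger parameter lies in the exit set
  set F : ℝ → ℝ := fun t ↦
    ρ (maximalGeodesic g.leviCivita x₀ u t) with hF
  have hFc : Continuous F := hρc.comp (continuous_maximalGeodesic g hg x₀ u)
  have hev : ∀ᶠ t in 𝓝 (sSup C), F t < 0 := hFc.continuousAt.eventually (gt_mem_nhds hneg)
  obtain ⟨ε, hε, hεF⟩ := Metric.eventually_nhds_iff.1 hev
  have hmem' : sSup C + ε / 2 ∈ C := by
    refine ⟨by linarith [hmem.1], fun t ht ↦ ?_⟩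
    by_cases htR : t ≤ sSup C
    · exact hmem.2 t ⟨ht.1, htR⟩
    · push Not at htR
      refine (hεF ?_).le
      rw [Real.dist_eq, abs_of_pos (by linarith)]
      linarith [ht.2]
  have := le_csSup hbdd hmem'
  linarith

/-- **Scaling of the exit set** (rescaling lemma `γ_{a u}(t) = γ_u(a t)`): for `a > 0`,
`c ∈ exitSet (a • u) ↔ a c ∈ exitSet u`. [cite: LeeRiemannianManifolds2018, Lemma 5.18] -/
theorem mem_exitSet_smul_iff (hg : g.IsRiemannian) {u : E} {a : ℝ} (ha : 0 < a) {c : ℝ} :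
    c ∈ {c : ℝ | 0 ≤ c ∧ ∀ t ∈ Icc (0 : ℝ) c,
        ρ (maximalGeodesic g.leviCivita x₀ (a • u) t) ≤ 0} ↔
      a * c ∈ {c : ℝ | 0 ≤ c ∧ ∀ t ∈ Icc (0 : ℝ) c,
        ρ (maximalGeodesic g.leviCivita x₀ u t) ≤ 0} := by
  haveI := contMDiffCovariantDerivative_leviCivita_smooth g
  have hc := isGeodesicallyComplete_of_smooth g hg
  have hresc : ∀ t : ℝ, maximalGeodesic g.leviCivita x₀ (a • u) t =
      maximalGeodesic g.leviCivita x₀ u (a * t) :=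
    fun t ↦ maximalGeodesic_smul hc x₀ u a t
  constructor
  · rintro ⟨hc0, h⟩
    refine ⟨mul_nonneg ha.le hc0, fun t ht ↦ ?_⟩
    have h' := h (t / a) ⟨div_nonneg ht.1 ha.le, by rw [div_le_iff₀ ha]; linarith [ht.2]⟩
    rwa [hresc, mul_div_cancel₀ _ ha.ne'] at h'
  · rintro ⟨hc0, h⟩
    refine ⟨nonneg_of_mul_nonneg_right hc0 ha, fun t ht ↦ ?_⟩
    rw [hresc]
    exact h (a * t) ⟨mul_nonneg ha.le ht.1, by nlinarith [ht.2]⟩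

/-- **Scaling of the exit parameter**: `R (a • u) = R u / a` for `a > 0`, `u ≠ 0`.
[cite: LeeRiemannianManifolds2018, Lemma 5.18] -/
theorem sSup_exitSet_smul (hg : g.IsRiemannian) (hρc : Continuous ρ)
    (hnt : IsNonTrappingSublevel g ρ) (hx₀ : ρ x₀ ≤ 0) {u : E} (hu : u ≠ 0) {a : ℝ} (ha : 0 < a) :
    sSup {c : ℝ | 0 ≤ c ∧ ∀ t ∈ Icc (0 : ℝ) c,
        ρ (maximalGeodesic g.leviCivita x₀ (a • u) t) ≤ 0} =
      sSup {c : ℝ | 0 ≤ c ∧ ∀ t ∈ Icc (0 : ℝ) c,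
        ρ (maximalGeodesic g.leviCivita x₀ u t) ≤ 0} / a := by
  set R := sSup {c : ℝ | 0 ≤ c ∧ ∀ t ∈ Icc (0 : ℝ) c,
    ρ (maximalGeodesic g.leviCivita x₀ u t) ≤ 0} with hR
  have hRmem := sSup_mem_exitSet hg hρc hnt hx₀ hu
  rw [← hR] at hRmem
  refine IsGreatest.csSup_eq ⟨?_, ?_⟩
  · rw [mem_exitSet_smul_iff hg ha, mul_div_cancel₀ _ ha.ne']
    exact hRmem
  · intro c hc
    have hc' := (mem_exitSet_smul_iff hg ha).1 hc
    have hle : a * c ≤ R := le_csSup (bddAbove_exitSet hg hnt hx₀ hu) hc'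
    rw [le_div_iff₀ ha, mul_comm]
    exact hle

/-- **Before the exit the geodesic is in the interior**: `ρ(γ_u t) < 0` for `0 ≤ t < R u` when
`ρ x₀ < 0` and `∂D` is strictly convex — a geodesic segment in `D` meets `∂D` only at its endpoints
(`IsStrictlyConvexSublevel.neg_of_mem_Ioo_of_isGeodesic`, PSU Lemma 3.1.12 as used in Prop. 3.7.21).
[cite: PaternainSaloUhlmann2023, Lemma 3.1.12] -/
theorem apply_lt_zero_of_lt_sSup_exitSet (hg : g.IsRiemannian)
    (hρ : ContMDiff 𝓘(ℝ, E) 𝓘(ℝ, ℝ) ∞ ρ) (hconv : IsStrictlyConvexSublevel g ρ)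
    (hnt : IsNonTrappingSublevel g ρ) (hx₀ : ρ x₀ < 0) {u : E} (hu : u ≠ 0) {t : ℝ} (ht0 : 0 ≤ t)
    (ht : t < sSup {c : ℝ | 0 ≤ c ∧ ∀ t ∈ Icc (0 : ℝ) c,
        ρ (maximalGeodesic g.leviCivita x₀ u t) ≤ 0}) :
    ρ (maximalGeodesic g.leviCivita x₀ u t) < 0 := by
  haveI := contMDiffCovariantDerivative_leviCivita_smooth g
  obtain ⟨hγ, h0, hv⟩ := isGeodesic_maximalGeodesic (isGeodesicallyComplete_of_smooth g hg) x₀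
    u
  rcases ht0.lt_or_eq with hpos | hzero
  · have hmem := sSup_mem_exitSet hg hρ.continuous hnt hx₀.le hu
    exact hconv.neg_of_mem_Ioo_of_isGeodesic hg (fun y ↦ (hρ y).of_le (WithTop.coe_le_coe.2 le_top))
      hγ (t₁ := 0) (hv.trans_ne hu) hmem.2 ⟨hpos, ht⟩
  · rw [← hzero]
    exact (congrArg ρ h0).trans_lt hx₀

/-- **The exit is transversal**: `dρ(γ_u'(R u)) > 0` at the exit parameter (strict convexity,
`IsStrictlyConvexSublevel.mvfderiv_velocity_pos_of_exit`; PSU Lemma 3.1.12 as used in Lemma 3.2.3).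
[cite: PaternainSaloUhlmann2023, Lemma 3.1.12] -/
theorem mvfderiv_velocity_pos_at_sSup_exitSet (hg : g.IsRiemannian)
    (hρ : ContMDiff 𝓘(ℝ, E) 𝓘(ℝ, ℝ) ∞ ρ) (hconv : IsStrictlyConvexSublevel g ρ)
    (hnt : IsNonTrappingSublevel g ρ) (hx₀ : ρ x₀ < 0) {u : E} (hu : u ≠ 0) :
    0 < mvfderiv 𝓘(ℝ, E) ρ
      (maximalGeodesic g.leviCivita x₀ u
        (sSup {c : ℝ | 0 ≤ c ∧ ∀ t ∈ Icc (0 : ℝ) c,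
          ρ (maximalGeodesic g.leviCivita x₀ u t) ≤ 0}))
      (velocity 𝓘(ℝ, E) (maximalGeodesic g.leviCivita x₀ u)
        (sSup {c : ℝ | 0 ≤ c ∧ ∀ t ∈ Icc (0 : ℝ) c,
          ρ (maximalGeodesic g.leviCivita x₀ u t) ≤ 0})) := by
  haveI := contMDiffCovariantDerivative_leviCivita_smooth g
  obtain ⟨hγ, h0, hv⟩ := isGeodesic_maximalGeodesic (isGeodesicallyComplete_of_smooth g hg) x₀
    u
  have hmem := sSup_mem_exitSet hg hρ.continuous hnt hx₀.le hu
  have hpos := sSup_exitSet_pos hg hρ.continuous hnt hx₀ hu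
  exact hconv.mvfderiv_velocity_pos_of_exit hγ isOpen_univ hpos (subset_univ _)
    (fun t _ ↦ (hρ _).of_le (WithTop.coe_le_coe.2 le_top)) hmem.2
    (apply_sSup_exitSet_eq_zero hg hρ.continuous hnt hx₀.le hu)
    (hγ.velocity_ne_zero g hg (t₀ := 0) (hv.trans_ne hu) _)

/-- **Continuity of the exit parameter** `R u = sSup (exitSet u)` on `E ∖ {0}` (PSU Lemma 3.2.3,
"`τ` is continuous on `SM`", in the sublevel rendering): upper semicontinuity because exceeding
the exit set is witnessed by a single time with `ρ > 0` (an open condition in `u`), lower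
semicontinuity because before the exit the geodesic is in the open interior, uniformly on compact
time intervals (`IsCompact.eventually_forall_of_forall_eventually`).
[cite: PaternainSaloUhlmann2023, Lemma 3.2.3] -/
theorem continuousAt_sSup_exitSet (hg : g.IsRiemannian)
    (hρ : ContMDiff 𝓘(ℝ, E) 𝓘(ℝ, ℝ) ∞ ρ) (hconv : IsStrictlyConvexSublevel g ρ)
    (hnt : IsNonTrappingSublevel g ρ) (hx₀ : ρ x₀ < 0) {u : E} (hu : u ≠ 0) :
    ContinuousAt (fun u : E ↦ sSup {c : ℝ | 0 ≤ c ∧ ∀ t ∈ Icc (0 : ℝ) c,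
      ρ (maximalGeodesic g.leviCivita x₀ u t) ≤ 0}) u := by
  have hρc := hρ.continuous
  have hF : Continuous fun q : ℝ × E ↦
      ρ (maximalGeodesic g.leviCivita x₀ q.2 q.1) :=
    hρc.comp (continuous_maximalGeodesic_family g hg x₀)
  have hune : ∀ᶠ u' in 𝓝 u, u' ≠ (0 : E) := isOpen_ne.eventually_mem hu
  set R : E → ℝ := fun u : E ↦ sSup {c : ℝ | 0 ≤ c ∧ ∀ t ∈ Icc (0 : ℝ) c,
    ρ (maximalGeodesic g.leviCivita x₀ u t) ≤ 0} with hR_def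
  rw [ContinuousAt, tendsto_order]
  constructor
  · -- lower semicontinuity
    intro c hc
    by_cases hc0 : c < 0
    · filter_upwards [hune] with u' hu'
      exact lt_trans hc0 (sSup_exitSet_pos hg hρc hnt hx₀ hu')
    · push Not at hc0
      set c' := (c + R u) / 2 with hc'
      have hcc' : c < c' := by rw [hc']; linarith
      have hc'R : c' < R u := by rw [hc']; linarith
      have hneg : ∀ t ∈ Icc (0 : ℝ) c',
          ρ (maximalGeodesic g.leviCivita x₀ u t) < 0 :=
        fun t ht ↦ apply_lt_zero_of_lt_sSup_exitSet hg hρ hconv hnt hx₀ hu ht.1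
          (lt_of_le_of_lt ht.2 hc'R)
      have hev : ∀ᶠ u' in 𝓝 u, ∀ t ∈ Icc (0 : ℝ) c',
          ρ (maximalGeodesic g.leviCivita x₀ u' t) < 0 := by
        refine (isCompact_Icc (a := (0 : ℝ)) (b := c')).eventually_forall_of_forall_eventually
          (P := fun (u' : E) (t : ℝ) ↦
            ρ (maximalGeodesic g.leviCivita x₀ u' t) < 0)
          fun t ht ↦ ?_
        have hc2 : Continuous fun z : E × ℝ ↦
            ρ (maximalGeodesic g.leviCivita x₀ z.1 z.2) :=
          hF.comp (continuous_snd.prodMk continuous_fst)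
        exact hc2.continuousAt.eventually (gt_mem_nhds (hneg t ht))
      filter_upwards [hev, hune] with u' hu' hu'0
      have hmem : c' ∈ {c : ℝ | 0 ≤ c ∧ ∀ t ∈ Icc (0 : ℝ) c,
          ρ (maximalGeodesic g.leviCivita x₀ u' t) ≤ 0} :=
        ⟨by linarith, fun t ht ↦ (hu' t ht).le⟩
      exact lt_of_lt_of_le hcc' (le_csSup (bddAbove_exitSet hg hnt hx₀.le hu'0) hmem)
  · -- upper semicontinuity
    intro c hc
    set c' := (c + R u) / 2 with hc'
    have hcc' : c' < c := by rw [hc']; linarith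
    have hRc' : R u < c' := by rw [hc']; linarith
    have hc'0 : 0 ≤ c' := le_trans (sSup_exitSet_pos hg hρc hnt hx₀ hu).le hRc'.le
    have hnot : c' ∉ {c : ℝ | 0 ≤ c ∧ ∀ t ∈ Icc (0 : ℝ) c,
        ρ (maximalGeodesic g.leviCivita x₀ u t) ≤ 0} := by
      intro h
      exact absurd ((mem_exitSet_iff_le_sSup hg hρc hnt hx₀.le hu hc'0).1 h) (not_le.2 hRc')
    simp only [mem_setOf_eq, not_and, not_forall] at hnot
    obtain ⟨t, ht, hρt⟩ := hnot hc'0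
    have hρt' : 0 < ρ (maximalGeodesic g.leviCivita x₀ u t) :=
      not_le.1 hρt
    have hev : ∀ᶠ u' in 𝓝 u,
        0 < ρ (maximalGeodesic g.leviCivita x₀ u' t) :=
      (hρc.comp (continuous_maximalGeodesic_apply g hg x₀ t)).continuousAt.eventually
        (lt_mem_nhds hρt')
    filter_upwards [hev, hune] with u' hu' hu'0
    have hlt : R u' < c' := by
      by_contra hle
      push Not at hle
      have hmem := (mem_exitSet_iff_le_sSup hg hρc hnt hx₀.le hu'0 hc'0).2 hle
      exact absurd (hmem.2 t ht) (not_le.2 hu')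
    exact lt_trans hlt hcc'

end ExitSet

end Literature.Geometry.Riemannian

end
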